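import Mathlib
import Summits.NavierStokesRegularity.NavierStokesRegularity.Theses.EulerZoomLiouville
import Summits.NavierStokesRegularity.NavierStokesRegularity.Theorems.EulerZoomLiouvillePowerGaugeEulerLiouvilleLargeRho
import Summits.NavierStokesRegularity.NavierStokesRegularity.Theorems.EulerZoomLiouvillePowerGaugeEulerLiouvilleBackwardVanishing
import Summits.NavierStokesRegularity.NavierStokesRegularity.Theorems.EulerZoomLiouvillePowerGaugeEulerLiouvillePastSymmetric
import HarnessLib.Audit

/-!
# Line `recurrent-past` (ideator ns-idea-11 g3, lens «complete» = program-completion) for the crux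
# `EulerZoomLiouville.PowerGaugeEulerLiouville` (stmt-NavierStokesRegularity-19832)

HONEST LABEL FIRST: corollary-grade line.  The kill is two LANDED theorems of the lead's programme — `Backward.vanishesBackward_of_gauge`
(the `A`+`E` gauges force the set of past times at which the slice carries local energy `> ε` on `B(R)` to have WINDOW DENSITY ZERO:
`|{τ ∈ (−a²,0)} ∩ Bad| / a² → 0`) and `PastSymmetric.ae_eq_zero_of_gauge_of_pastSlicesZero` (a.e.-vanishing far-past slices ⇒ trivial) — joined by
ONE observation and ONE measure-theoretic lemma.  What it COMPLETES: the periodic chapter of `birth` (v36: STEADY, TIME-PERIODIC, PAST-TIME-PERIODIC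
members, `ae_eq_zero_of_gauge_of_periodicGradient`) to its dynamical-systems closure, the POINCARÉ-RECURRENT members: those whose a.e. far-past slice
`u(τ₀)` is revisited, in `L²(B_R)` up to `ε` (time-averaged over a short window, so that exactly periodic and Stepanov-almost-periodic members qualify
without any time-continuity), on a set of past times of NON-ZERO window density — for every `R`, `ε`.  Periodic ⊊ quasi-periodic ⊊ almost-periodic ⊊
recurrent.  DISTANCE / BREADTH LABEL (idea-crit-8 g2 V28, 2026-08-28T08:05Z, PASS-WITH-PRICE thin/corollary-grade, P1 verbatim): the
time-quasi-periodic populations in print (Crouseilles–Faou 2013 (2D); Enciso–Peralta-Salas–Torres de Lizaur arXiv:2209.09812; Baldi–Montalto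
arXiv:2003.14313 and Franzoi–Montalto arXiv:2312.10514 on T³) are NOT candidates for the class for ANY ρ > −1 — they are excluded AT SIGHT by the
E-gauge alone, before any recurrence argument: `cknE a = a⁻¹∫∫_{Q_a}|∇u|²`, and a smooth flow whose enstrophy on one fixed ball is `≥ e₀` on a set of
past times of window density `≥ d₀` has `a^ρ·E(a) ≥ e₀d₀·a^{1+ρ} → ∞`; so R2 removes no live blow-up-profile candidate — the live ones (DSS /
log-periodic and the α-self-similar Chae–Shvydkoy-window profiles named in the crux's why-it-might-fail) are SCALING-recurrent, not
time-translation-recurrent, and sit in R3.  «value = census completeness (the recurrent hull of birth's periodic chapter, for every ρ > 0); width on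
the crux = 0».  P2 (staffing, verbatim): NO seat, NO new unit — R1+R2 are ONE small filler (S + M) for LEAD ns-typeII-p2's birth chapter next to
`…_of_periodicGradient` (suggested landing shape `ae_eq_zero_of_gauge_of_pastRecurrent`, R1 private), or LAST in the single 19832 unit
(K2≡M3 → K1/M2 → M1 → K3/M4 → R1/R2); zero width on R3.  P3 none.

THE OBSERVATION.  Fix a recurrent slice `τ₀` and `R`, `ε`, window `h`.  Returns `σ` have `∫_{σ−h}^{σ}‖u(τ)−u(τ₀)‖²_{L²(B_R)}dτ < hε`, so three quarters of
the window is `4ε`-close to `u(τ₀)`; the smeared bad set `{σ : |Bad ∩ (σ−h,σ)| > h/2}` still has window density zero (averaging); a set of non-zero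
upper window density is not contained in one of density zero (R1 `stub_densityMeet`); so some window contains a time that is both `4ε`-close to
`u(τ₀)` and `ε`-small on `B(R)`: `‖u(τ₀)‖_{L²(B_R)} ≤ 3√ε`.  All `R`, `ε` ⇒ `u(τ₀) = 0`; a.e. `τ₀ < T₁` ⇒ the landed filler (R2 `stub_recurrentSlicesZero`
produces exactly its hypothesis `hzero`, and the COMPOSITION applies the filler by name).  Residue R3 `stub_wanderingRest` (members with a
wandering = non-recurrent past) is the crux minus the stratum, OPEN, NOT claimed.  Works for every `ρ > 0` (no `ρ ≤ 1/2` needed inside the stratum).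
New lever: none deep — the density-one/positive-density MEET replacing exact periodicity; value = breadth (a natural dynamical class typed and closed
cheaply: R1 S, R2 M).  No summit is proved by a line.
-/

open MeasureTheory Set Filter Topology Metric
open scoped ENNReal NNReal
open Literature.Analysis Literature.Analysis.FluidPDE

set_option linter.dupNamespace false

namespace Summit.NavierStokesRegularity.NavierStokesRegularity.Cruxes.PowerGaugeEulerLiouville.RecurrentPast

/-- Local abbreviation: ℝ³. -/
abbrev E3 : Type := EuclideanSpace ℝ (Fin 3)

/-- Membership in Seregin's power-gauged ancient Euler class — verbatim the three hypotheses of the crux (same as `Birth.InClass`). -/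
@[reducible] def InClass (ρ : ℝ) (u : ℝ → E3 → E3) (p : ℝ → E3 → ℝ) (H : ℝ → E3 → E3 →L[ℝ] E3)
    (c : ℝ≥0) : Prop :=
  IsSuitableWeakSolutionOn (slab (EuclideanSpace ℝ (Fin 3)) (Set.Iio 0) isOpen_Iio) 0 0 u p ∧
    HasWeakSpatialGradientOn (slab (EuclideanSpace ℝ (Fin 3)) (Set.Iio 0) isOpen_Iio) u H ∧
    (∀ a : ℝ, 0 < a →
      ENNReal.ofReal (a ^ (2 * ρ)) * cknA a (0 : ℝ × E3) u + ENNReal.ofReal (a ^ ρ) * cknE a (0 : ℝ × E3) H +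
        ENNReal.ofReal (a ^ (2 * ρ)) * cknD a (0 : ℝ × E3) p ≤ (c : ℝ≥0∞))

/-- The conclusion of the crux: `u` vanishes a.e. on the past slab. -/
@[reducible] def VanishesAE (u : ℝ → E3 → E3) : Prop :=
  Function.uncurry u =ᵐ[volume.restrict (Set.Iio (0 : ℝ) ×ˢ (Set.univ : Set E3))] 0

/-- A set of times has WINDOW DENSITY ZERO if its share of the parabolic windows `(−a², 0)` tends to `0` (the normalisation of
`Backward.vanishesBackward_of_gauge`). -/
def WindowDensityZero (S : Set ℝ) : Prop :=
  Tendsto (fun a : ℝ => volume (S ∩ Set.Ioo (-(a ^ 2)) 0) / ENNReal.ofReal (a ^ 2)) atTop (𝓝 0)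

/-- The RETURN SET of the slice `u(τ₀)` at spatial radius `R`, tolerance `ε`, time window `h`: past times `σ < 0` such that on the window `(σ−h, σ)` the
slices are `ε`-close to `u(τ₀)` in `L²(B(0,R))` ON AVERAGE, `∫_{σ−h}^{σ} ∫_{B_R} |u(τ,y) − u(τ₀,y)|² dy dτ < h ε` (time-averaged so that no time-continuity
of the weak solution is presupposed). -/
def returnSet (u : ℝ → E3 → E3) (τ₀ R ε h : ℝ) : Set ℝ :=
  {σ : ℝ | σ < 0 ∧
    ∫⁻ τ in Set.Ioo (σ - h) σ, ∫⁻ y in ball (0 : E3) R, ‖u τ y - u τ₀ y‖ₑ ^ 2 < ENNReal.ofReal (h * ε)}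

/-- THE STRATUM: the member has a POINCARÉ-RECURRENT PAST — below some `T₁ ≤ 0`, a.e. slice is revisited (every `R`, `ε`, some window `h`) on a set of
past times whose window density is NOT zero.  Contains every member that is periodic, quasi-periodic or (Stepanov-)almost-periodic in time on
`(−∞, T₁)` as an `L²_loc`-valued function. -/
def IsPastRecurrent (u : ℝ → E3 → E3) : Prop :=
  ∃ T₁ : ℝ, T₁ ≤ 0 ∧ ∀ᵐ τ₀ ∂(volume.restrict (Set.Iio T₁)),
    ∀ R ε : ℝ, 0 < R → 0 < ε → ∃ h : ℝ, 0 < h ∧ ¬ WindowDensityZero (returnSet u τ₀ R ε h)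

/-! ## Registered stub signatures -/

/-- Signature of `stub_densityMeet` (R1, size S): a set of times whose window density is not zero is not contained in one whose window density is
zero.  Proof: if `Ret ⊆ Bad` then `volume (Ret ∩ I_a) ≤ volume (Bad ∩ I_a)` and the quotient is squeezed to `0`. -/
def Sig.stub_densityMeet : Prop :=
  ∀ Bad Ret : Set ℝ, WindowDensityZero Bad → ¬ WindowDensityZero Ret → ∃ σ ∈ Ret, σ ∉ Bad

/-- Signature of `stub_recurrentSlicesZero` (R2, size M): GIVEN R1, a member of the class (`ρ > 0`) with a recurrent past below `T₁` has a.e.-vanishing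
slices below `T₁` — exactly the hypothesis `hzero` of `PastSymmetric.ae_eq_zero_of_gauge_of_pastSlicesZero`.  Proof: for a recurrent `τ₀` and rational
`R, ε`: `Bad := {τ ∈ (−∞,0) : ε < ∫_{B_R}|u(τ)|²}` has window density zero (`Backward.vanishesBackward_of_gauge`, from the `A` and `E` parts of `InClass`),
hence so does the smeared set `{σ : volume (Bad ∩ (σ−h,σ)) > h/2}` (Fubini averaging); R1 gives a return `σ` outside it; Chebyshev on the return window:
`volume {τ ∈ (σ−h,σ) : 4ε ≤ ‖u(τ)−u(τ₀)‖²_{L²(B_R)}} ≤ h/4`; so some `τ` in the window is good on both counts and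
`‖u(τ₀)‖_{L²(B_R)} ≤ ‖u(τ)‖ + ‖u(τ)−u(τ₀)‖ ≤ 3√ε`; let `ε ↓ 0`, `R ↑ ∞` along rationals. -/
def Sig.stub_recurrentSlicesZero : Prop :=
  Sig.stub_densityMeet →
    ∀ ρ : ℝ, 0 < ρ → ∀ (u : ℝ → E3 → E3) (p : ℝ → E3 → ℝ) (H : ℝ → E3 → E3 →L[ℝ] E3) (c : ℝ≥0),
      InClass ρ u p H c → ∀ T₁ : ℝ, T₁ ≤ 0 →
        (∀ᵐ τ₀ ∂(volume.restrict (Set.Iio T₁)),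
          ∀ R ε : ℝ, 0 < R → 0 < ε → ∃ h : ℝ, 0 < h ∧ ¬ WindowDensityZero (returnSet u τ₀ R ε h)) →
        ∀ᵐ τ ∂(volume.restrict (Set.Iio T₁)), ∫⁻ x, ‖u τ x‖ₑ ^ 2 = 0

/-- Signature of `stub_wanderingRest` (R3, OPEN, crux-sized — NOT claimed by this line): in the window `0 < ρ ≤ 1/2`, members with a WANDERING
(non-recurrent) past are trivial.  This is where `birth`'s open stubs live, minus the stratum. -/
def Sig.stub_wanderingRest : Prop :=
  ∀ ρ : ℝ, 0 < ρ → ρ ≤ 1 / 2 → ∀ (u : ℝ → E3 → E3) (p : ℝ → E3 → ℝ) (H : ℝ → E3 → E3 →L[ℝ] E3) (c : ℝ≥0),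
    InClass ρ u p H c → ¬ IsPastRecurrent u → VanishesAE u

/-! ## Stubs -/

/-- STUB R1 [provable, S]. -/
theorem stub_densityMeet : Sig.stub_densityMeet := by
  sorry

/-- STUB R2 [provable, M]. -/
theorem stub_recurrentSlicesZero : Sig.stub_recurrentSlicesZero := by
  sorry

/-- STUB R3 [OPEN residue, not claimed]. -/
theorem stub_wanderingRest : Sig.stub_wanderingRest := by
  sorry

/-! ## Composition -/

/-- **Composition (kernel-checked, no sorry of its own): the three stubs give the crux BY NAME; on the stratum the landed filler
`PastSymmetric.ae_eq_zero_of_gauge_of_pastSlicesZero` is applied here, in the composition itself.** -/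
theorem PowerGaugeEulerLiouville_of :
    Sig.stub_densityMeet → Sig.stub_recurrentSlicesZero → Sig.stub_wanderingRest →
      Summit.NavierStokesRegularity.NavierStokesRegularity.Theses.EulerZoomLiouville.PowerGaugeEulerLiouville := by
  intro h1 h2 h3 ρ hρ u p H c hsw hH hc
  by_cases hhalf : 1 / 2 < ρ
  · exact
      Summit.NavierStokesRegularity.NavierStokesRegularity.Theorems.PowerGaugeEulerLiouville.powerGaugeEulerLiouville_largeRho
        ρ hhalf u p H c hsw hH hc
  · have hρ2 : ρ ≤ 1 / 2 := not_lt.mp hhalf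
    by_cases hS : IsPastRecurrent u
    · obtain ⟨T₁, hT₁, hrec⟩ := hS
      have hzero : ∀ᵐ τ ∂(volume.restrict (Set.Iio T₁)), ∫⁻ x, ‖u τ x‖ₑ ^ 2 = 0 :=
        h2 h1 ρ hρ u p H c ⟨hsw, hH, hc⟩ T₁ hT₁ hrec
      exact
        Summit.NavierStokesRegularity.NavierStokesRegularity.Theorems.PowerGaugeEulerLiouville.PastSymmetric.ae_eq_zero_of_gauge_of_pastSlicesZero
          hρ.le hsw hH hc hzero
    · exact h3 ρ hρ hρ2 u p H c ⟨hsw, hH, hc⟩ hS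

end Summit.NavierStokesRegularity.NavierStokesRegularity.Cruxes.PowerGaugeEulerLiouville.RecurrentPast
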